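import Literature.NumberTheory.DiophantineGeometry.CatalanCasselsTheorem
import Mathlib.NumberTheory.NumberField.Cyclotomic.Ideal
import HarnessLib

/-!
# The obstruction group: `x - ζ_p` generates `𝔭` times a `q`-th power (Schoof, Chapter 7)

[Schoof2009, Chapter 7] attaches to a non-zero solution of Catalan's equation `x ^ p - y ^ q = 1`
(`p, q` odd primes) the element `x - ζ_p` of the `p`-th cyclotomic field `K = ℚ(ζ_p)` and shows:

* **Proposition 7.2**: `ord_𝔯 (x - ζ_p) ≡ 0 (mod q)` for every prime `𝔯 ≠ 𝔭 = (1 - ζ_p)` of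
  `ℤ[ζ_p]` — the factors `x - ζ` of `∏_{ζ ∈ μ_p} (x - ζ) = y ^ q` are pairwise coprime away
  from `𝔭`;
* **Proposition 7.3**: `ord_𝔭 (x - ζ_p) = 1` — by Cassels' theorem (Corollary 6.5),
  `x ≡ 1 (mod p)`.

Together: the ideal `(x - ζ_p)` of `ℤ[ζ_p]` equals `𝔭 · 𝔞 ^ q` for an ideal `𝔞` prime to `𝔭`.
This file proves exactly this, in the ring of integers `𝓞 K` of an arbitrary `p`-th cyclotomic
field `K`, for all the conjugates `x - ζ_p^i` at once:

* `Catalan.prod_Ico_X_sub_C_zeta_pow`, `Catalan.prod_Ico_sub_zeta_pow`,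
  `Catalan.prod_Ico_one_sub_zeta_pow` — `∏_{1 ≤ i < p} (X - ζ^i) = 1 + X + ⋯ + X^(p-1)` and
  its values (`∏ (1 - ζ^i) = p`);
* `Catalan.span_sub_zeta_pow_eq` — **[Schoof2009, Propositions 7.2–7.3]**: for a non-zero solution
  and every `1 ≤ i < p` there is an ideal `𝔞ᵢ`, coprime to `𝔭 = (ζ_p - 1)`, with
  `(x - ζ_p^i) = 𝔭 · 𝔞ᵢ ^ q`.

The proof follows the book with Corollary 6.5 made explicit: `x - 1 = p m` with `p ∣ m`
(as `q ≥ 3`), `p = ∏ (1 - ζ^j)`, so `x - ζ^i = (1 - ζ^i) tᵢ` with `tᵢ = 1 + m ∏_{j ≠ i} (1 - ζ^j)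
≡ 1 (mod p)`; the `tᵢ` are pairwise coprime (a common divisor divides `ζ^j - ζ^i ∼ 1 - ζ_p` and
`tᵢ ≡ 1`) with product `(x^p - 1)/(p (x - 1)) = v ^ q`, so each `(tᵢ)` is a `q`-th power of an
ideal by unique factorisation of ideals in the Dedekind domain `𝓞 K`. This is the input of
[Schoof2009, Proposition 10.1 / Theorem 10.2] (Mihăilescu's Theorem I) and of Chapters 8, 11, 12.
No named fact is introduced.

## References

* R. Schoof, *Catalan's Conjecture*, Universitext, Springer 2009 [Schoof2009], Chapter 7
  (Lemma 7.1, Propositions 7.2, 7.3; book pp. 41–43) — held,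
  `lit read book:schoof2009-catalan-s-conjecture` (PDF pp. 120–122).
-/

namespace Literature.NumberTheory.DiophantineGeometry

namespace Catalan

open Finset NumberField Polynomial

section Cyclotomic

variable {p : ℕ} [hp : Fact p.Prime] {K : Type*} [Field K] [NumberField K] {ζ : K}
  (hζ : IsPrimitiveRoot ζ p)

/-! ### `∏_{1 ≤ i < p} (X - ζ^i) = Φ_p(X) = 1 + X + ⋯ + X^(p-1)` -/

/-- In `ℤ[ζ_p][X]`: `∏_{1 ≤ i < p} (X - ζ^i) = Σ_{i < p} X^i` (both are `(X^p - 1)/(X - 1)`).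
[folklore] -/
theorem prod_Ico_X_sub_C_zeta_pow :
    ∏ i ∈ Ico 1 p, (X - C (hζ.toInteger ^ i)) = ∑ i ∈ range p, (X : (𝓞 K)[X]) ^ i := by
  classical
  set z := hζ.toInteger with hzdef
  have hz : IsPrimitiveRoot z p := hζ.toInteger_isPrimitiveRoot
  have h1 : (X : (𝓞 K)[X]) ^ p - 1 = ∏ i ∈ range p, (X - C (z ^ i)) := by
    rw [X_pow_sub_one_eq_prod hp.out.pos hz]
    have hset : nthRootsFinset p (1 : 𝓞 K) = (range p).image (fun i => z ^ i) := by
      ext μ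
      rw [mem_nthRootsFinset hp.out.pos, mem_image]
      constructor
      · intro hμ
        obtain ⟨i, hi, rfl⟩ := hz.eq_pow_of_pow_eq_one hμ
        exact ⟨i, mem_range.mpr hi, rfl⟩
      · rintro ⟨i, -, rfl⟩
        rw [← pow_mul, mul_comm, pow_mul, hz.pow_eq_one, one_pow]
    rw [hset, prod_image fun i hi j hj hij => hz.injOn_pow hi hj hij]
  have h2 : ∏ i ∈ range p, (X - C (z ^ i)) = (X - 1) * ∏ i ∈ Ico 1 p, (X - C (z ^ i)) := by
    rw [prod_range_eq_mul_Ico _ hp.out.pos, pow_zero, C_1]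
  have h3 : (X : (𝓞 K)[X]) ^ p - 1 = (X - 1) * ∑ i ∈ range p, (X : (𝓞 K)[X]) ^ i := by
    rw [mul_comm, geom_sum_mul]
  have hX : (X : (𝓞 K)[X]) - 1 ≠ 0 := by
    simpa only [C_1] using X_sub_C_ne_zero (1 : 𝓞 K)
  apply mul_left_cancel₀ hX
  rw [← h2, ← h1, h3]

/-- `∏_{1 ≤ i < p} (w - ζ^i) = Σ_{i < p} w^i` for every `w ∈ ℤ[ζ_p]`. [folklore] -/
theorem prod_Ico_sub_zeta_pow (w : 𝓞 K) :
    ∏ i ∈ Ico 1 p, (w - hζ.toInteger ^ i) = ∑ i ∈ range p, w ^ i := by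
  have h := congrArg (eval w) (prod_Ico_X_sub_C_zeta_pow hζ)
  simpa only [eval_prod, eval_sub, eval_X, eval_C, eval_finsetSum, eval_pow] using h

/-- `∏_{1 ≤ i < p} (1 - ζ^i) = p` in `ℤ[ζ_p]` (the value `Φ_p(1) = p`). [folklore] -/
theorem prod_Ico_one_sub_zeta_pow : ∏ i ∈ Ico 1 p, (1 - hζ.toInteger ^ i) = (p : 𝓞 K) := by
  rw [prod_Ico_sub_zeta_pow hζ 1]
  simp

/-! ### Propositions 7.2 and 7.3: `(x - ζ_p^i) = 𝔭 · 𝔞ᵢ^q` -/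

variable [IsCyclotomicExtension {p} ℚ K]

/-- **[Schoof2009, Propositions 7.2 and 7.3]** (the ideal generated by `x - ζ_p`). Let `p, q` be
odd primes, `x, y` non-zero integers with `x ^ p - y ^ q = 1`, and `K` a `p`-th cyclotomic field
with `ζ = ζ_p`. Then for every `1 ≤ i < p` the ideal `(x - ζ^i)` of `𝓞 K = ℤ[ζ_p]` is
`𝔭 · 𝔞ᵢ ^ q` with `𝔭 = (ζ - 1)` the prime above `p` and `𝔞ᵢ` an ideal coprime to `𝔭`: i.e.
`ord_𝔯 (x - ζ^i) ≡ 0 (mod q)` for all primes `𝔯 ≠ 𝔭` (Proposition 7.2: the class of `x - ζ_p`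
lies in the obstruction group `H`) and `ord_𝔭 (x - ζ^i) = 1` (Proposition 7.3, from Cassels'
theorem via Corollary 6.5: `x ≡ 1 (mod p)`).
[cite: Schoof2009, Proposition 7.2] [cite: Schoof2009, Proposition 7.3] -/
theorem span_sub_zeta_pow_eq {q : ℕ} (hq : q.Prime) (hpo : Odd p) (hqo : Odd q) {x y : ℤ}
    (hx : x ≠ 0) (hy : y ≠ 0) (h : x ^ p - y ^ q = 1) :
    ∃ 𝔞 : ℕ → Ideal (𝓞 K), ∀ i ∈ Ico 1 p,
      Ideal.span {(x : 𝓞 K) - hζ.toInteger ^ i} = Ideal.span {hζ.toInteger - 1} * 𝔞 i ^ q ∧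
        IsCoprime (Ideal.span {hζ.toInteger - 1}) (𝔞 i) := by
  classical
  -- `p ≠ q` (Lemma 6.1) and `q ≥ 3`
  have hp3 : 3 ≤ p := by
    have := hp.out.two_le
    obtain ⟨k, hk⟩ := hpo
    omega
  have hq3 : 3 ≤ q := by
    have := hq.two_le
    obtain ⟨k, hk⟩ := hqo
    omega
  -- Corollary 6.5 (i): `x - 1 = p^(q-1) a^q` and `(x^p - 1)/(x - 1) = p v^q`
  obtain ⟨a, v, h1, h2, -, -, -⟩ := cassels_padic hp.out hq hpo hqo hx hy h
  set z : 𝓞 K := hζ.toInteger with hzdef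
  have hz : IsPrimitiveRoot z p := hζ.toInteger_isPrimitiveRoot
  set π : 𝓞 K := z - 1 with hπdef
  -- `x - 1 = p m` with `p ∣ m`
  set m : ℤ := (p : ℤ) ^ (q - 2) * a ^ q with hm
  have hxm : x - 1 = p * m := by
    rw [h1, hm, ← mul_assoc, ← pow_succ']
    congr 2
    omega
  have hpm : (p : 𝓞 K) ∣ (m : 𝓞 K) := by
    refine ⟨(p : 𝓞 K) ^ (q - 3) * (a : 𝓞 K) ^ q, ?_⟩
    rw [hm]
    push_cast
    rw [← mul_assoc, ← pow_succ']
    congr 2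
    omega
  -- `e i = ∏_{j ≠ i} (1 - z^j)`, `(1 - z^i) e i = p`, `t i = 1 + m e i`, `x - z^i = (1 - z^i) t i`
  set e : ℕ → 𝓞 K := fun i => ∏ j ∈ (Ico 1 p).erase i, (1 - z ^ j) with hedef
  have he : ∀ i ∈ Ico 1 p, (1 - z ^ i) * e i = p := fun i hi => by
    rw [hedef, mul_prod_erase (Ico 1 p) (fun j => 1 - z ^ j) hi, prod_Ico_one_sub_zeta_pow hζ]
  set t : ℕ → 𝓞 K := fun i => 1 + (m : 𝓞 K) * e i with htdef
  have ht : ∀ i ∈ Ico 1 p, (x : 𝓞 K) - z ^ i = (1 - z ^ i) * t i := fun i hi => by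
    have : (x : 𝓞 K) = p * m + 1 := by
      have := congrArg (Int.cast : ℤ → 𝓞 K) hxm
      push_cast at this
      linear_combination this
    rw [this, htdef]
    simp only
    rw [← he i hi]
    ring
  -- `∏ t i = v ^ q`
  have hprod : ∏ i ∈ Ico 1 p, t i = (v : 𝓞 K) ^ q := by
    have hP : ∏ i ∈ Ico 1 p, ((x : 𝓞 K) - z ^ i) = (p : 𝓞 K) * (v : 𝓞 K) ^ q := by
      rw [prod_Ico_sub_zeta_pow hζ (x : 𝓞 K)]
      have := congrArg (Int.cast : ℤ → 𝓞 K) h2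
      push_cast at this
      exact this
    have hP' : ∏ i ∈ Ico 1 p, ((x : 𝓞 K) - z ^ i) = (p : 𝓞 K) * ∏ i ∈ Ico 1 p, t i := by
      rw [prod_congr rfl ht, prod_mul_distrib, prod_Ico_one_sub_zeta_pow hζ]
    have hp0 : (p : 𝓞 K) ≠ 0 := Nat.cast_ne_zero.mpr hp.out.ne_zero
    exact mul_left_cancel₀ hp0 (hP'.symm.trans hP)
  -- `t i ≡ 1 (mod π)`
  have hπp : π ∣ (p : 𝓞 K) := hζ.toInteger_sub_one_dvd_prime'
  have ht1 : ∀ i, ∃ k : 𝓞 K, t i = 1 + π * k := fun i => by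
    obtain ⟨c, hc⟩ := hπp.trans hpm
    exact ⟨c * e i, by rw [htdef]; simp only; rw [hc]; ring⟩
  -- `z^j - z^i` is `π` times a unit, for `i < j` in `[1, p)`
  have hassoc : ∀ i ∈ Ico 1 p, ∀ j ∈ Ico 1 p, i < j → ∃ c : 𝓞 K, π = c * (z ^ j - z ^ i) := by
    intro i hi j hj hij
    rw [mem_Ico] at hi hj
    have hcop : (j - i).Coprime p :=
      (Nat.coprime_of_lt_prime (by omega) (by omega) hp.out).symm
    obtain ⟨u, hu⟩ := hz.associated_sub_one_pow_sub_one_of_coprime hcop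
    -- `hu : (z - 1) * u = z ^ (j - i) - 1`
    obtain ⟨w, hw⟩ := (hz.isUnit hp.out.ne_zero).pow i
    -- `hw : ↑w = z ^ i`
    refine ⟨↑(u⁻¹ * w⁻¹), ?_⟩
    have : z ^ j - z ^ i = z ^ i * (z ^ (j - i) - 1) := by
      rw [mul_sub, ← pow_add, mul_one]
      congr 2
      omega
    rw [this, ← hu, ← hw, Units.val_mul, hπdef]
    calc z - 1 = ((↑u⁻¹ * ↑u) * (↑w⁻¹ * ↑w) : 𝓞 K) * (z - 1) := by simp
      _ = _ := by ring
  -- pairwise coprimality of the `t i`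
  have hcop' : ∀ i ∈ Ico 1 p, ∀ j ∈ Ico 1 p, i < j → IsCoprime (t i) (t j) := by
    intro i hi j hj hij
    obtain ⟨c, hc⟩ := hassoc i hi j hj hij
    obtain ⟨k, hk⟩ := ht1 i
    -- `(1 - z^i) t i - (1 - z^j) t j = z^j - z^i`
    have hdiff : (1 - z ^ i) * t i - (1 - z ^ j) * t j = z ^ j - z ^ i := by
      rw [← ht i hi, ← ht j hj]; ring
    refine ⟨1 - k * c * (1 - z ^ i), k * c * (1 - z ^ j), ?_⟩
    have hπ : π = c * ((1 - z ^ i) * t i - (1 - z ^ j) * t j) := by rw [hdiff]; exact hc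
    linear_combination hk + k * hπ
  have hcop : ∀ i ∈ Ico 1 p, ∀ j ∈ Ico 1 p, i ≠ j →
      IsCoprime (Ideal.span {t i}) (Ideal.span {t j}) := by
    intro i hi j hj hij
    rw [Ideal.isCoprime_span_singleton_iff]
    rcases lt_or_gt_of_ne hij with hlt | hgt
    · exact hcop' i hi j hj hlt
    · exact (hcop' j hj i hi hgt).symm
  -- the ideals `(t i)` are `q`-th powers
  have hprodI : ∏ i ∈ Ico 1 p, Ideal.span {t i} = (Ideal.span {(v : 𝓞 K)}) ^ q := by
    rw [Ideal.prod_span_singleton, hprod, Ideal.span_singleton_pow]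
  have hpow := Finset.exists_eq_pow_of_mul_eq_pow_of_coprime hcop hprodI
  choose! 𝔞 h𝔞 using hpow
  refine ⟨𝔞, fun i hi => ⟨?_, ?_⟩⟩
  · -- `(x - z^i) = (1 - z^i)(t i) = (z - 1) · 𝔞 i ^ q`
    have hmem := hi
    rw [mem_Ico] at hmem
    have hassoc1 : Ideal.span {1 - z ^ i} = Ideal.span {z - 1} := by
      rw [show (1 : 𝓞 K) - z ^ i = -(z ^ i - 1) by ring, Ideal.span_singleton_neg]
      exact (Ideal.span_singleton_eq_span_singleton.mpr
        (hz.associated_sub_one_pow_sub_one_of_coprime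
          (Nat.coprime_of_lt_prime (by omega) hmem.2 hp.out).symm)).symm
    rw [ht i hi, ← Ideal.span_singleton_mul_span_singleton, hassoc1, h𝔞 i hi]
  · -- coprimality with `𝔭`: `t i ≡ 1 (mod π)`
    obtain ⟨k, hk⟩ := ht1 i
    have hπt : IsCoprime (Ideal.span {π}) (Ideal.span {t i}) := by
      rw [Ideal.isCoprime_span_singleton_iff]
      exact ⟨-k, 1, by rw [hk]; ring⟩
    rw [h𝔞 i hi] at hπt
    exact (IsCoprime.pow_right_iff hq.pos).mp hπt

end Cyclotomic

end Catalan

end Literature.NumberTheory.DiophantineGeometry
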